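import Mathlib
import Literature.NumberTheory.Congruences.ZolotarevLemmaJacobi
import Literature.NumberTheory.Congruences.ZolotarevReciprocity
import Literature.NumberTheory.Congruences.GaussLemmaHalfSystem
import Literature.GroupTheory.CayleySignature
import HarnessLib

/-!
# Cartier's theorem on the signature of an automorphism of a group of odd order: the generalized Gauss lemma
# `ϵ(u) = (−1)^{#(u(S) ∩ S^{−1})}`, `ϵ_G(u) = ϵ_N(u|_N) · ϵ_{G/N}(ū)`, and the signature `(−1)^{(#G−1)/2}` of inversion
# (Brunyate–Clark, *Extending the Zolotarev–Frobenius approach to quadratic reciprocity*, §6 Theorem 6.2 (Cartier 1970),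
# §3.2 Theorem 3.2)

Layer `Literature/GroupTheory`, namespace `Literature.GroupTheory`; lane `lit-hodgefound` (Track 2 foundations library), prover
seat `lit-hodgefound-p06`, generation 50, self-proposed rows g50-#5 and g50-#7 (append: (c)). Theorems only: no definition,
no instance, no notation, no named fact. The `ℤ/m`-with-`x ↦ ax` case of (a) is `NumberTheory/Congruences/GaussLemmaHalfSystem.lean` (g49-#3,
Lemmermeyer's Prop. 3.11, whose Frobenius pairing argument is re-run here multiplicatively; its `sign_toPerm_units_int` is
reused); (b) uses `CayleySignature.exists_equiv_quotient_prod` (coset representatives `G ≃ (G/N) × N`) and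
`ZolotarevReciprocity.sign_toPerm_self_eq_one_of_odd_card` (Lemma 2.2 (b): translations of an odd-order group are even).

## Source, verbatim ([BrunyateClark2014] §6, held `paper:doi-10-1007-s11139-014-9635-y` p. 20)

"Cartier's approach to Corollary 2.7 uses the following result. **Theorem 6.2.** (Cartier) Let `u` be an automorphism of a
finite odd order group `G`. a) (Generalized Gauss's Lemma) Let `S ⊂ G ∖ {e}` be such that `S ∩ S^{−1} = ∅` and
`S ∪ S^{−1} = G ∖ {e}`. Then the signature of `u` on `G` is `(−1)^{#(u(S) ∩ S^{−1})}`. b) If `u` stabilizes a normal subgroup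
`N` of `G`, the signature of `u` on `G` is equal to the signature of `u` on `N` times the signature of the induced automorphism
on `G/N`." §3.2 (p. 15): "**Theorem 3.2.** Let `b` be an odd ideal in an abstract number ring `R`. Then
`(−1/b) = [−1 / R/b] = (−1)^{(|b|−1)/2}`. Proof. By Corollary 2.7, `(−1/b) = [−1 / R/b]`. Since `R/b` is odd, the only `x ∈ R/b`
with `2x = 0` is `x = 0`. Thus `[−1/r]` is a product of `(|b|−1)/2` 2-cycles `x ↦ −x ↦ x`." (The source states Theorem 6.2, citing P. Cartier, *Sur une généralisation des symboles de Legendre–Jacobi*,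
Enseignement Math. 16 (1970) 31–48 [Ca70], and does not reprint the proof; the proofs below are the pairing argument of
Frobenius/Lemmermeyer §3.2.4 for (a) and the coset-representative computation for (b).)

## What is typed

A "half system" `S` of `G` is a finite set with `e ∉ S` and, for every `x ≠ e`, exactly one of `x, x^{−1}` in `S`
(`h1 : 1 ∉ S`, `hS : ∀ x ≠ 1, x ∈ S ↔ x⁻¹ ∉ S`; it exists iff `#G` is odd: `exists_halfSystem_of_odd_card`). The signature of
`u` on `G` is `Perm.sign (u.toEquiv : Perm G)`.
* (a) **`sign_eq_neg_one_pow_card_of_halfSystem`** — for ANY permutation `u` of `G` commuting with inversion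
  (`u(x^{−1}) = u(x)^{−1}`; automorphisms, power maps): `ϵ(u) = (−1)^{#{s ∈ S : u(s) ∉ S}}`;
  `sign_mulEquiv_eq_neg_one_pow_card_of_halfSystem` (automorphisms); `card_image_inter_image_inv_eq` (the printed exponent
  `#(u(S) ∩ S^{−1})` equals `#{s ∈ S : u(s) ∉ S}`); `exists_halfSystem_of_odd_card`.
* (b) **`sign_eq_sign_subtypePerm_mul_sign_quotient`** — `#G` odd, `N ⊴ G` with `u(x) ∈ N ⟺ x ∈ N`:
  `ϵ_G(u) = ϵ_N(u|_N) · ϵ_{G/N}(ū)`, `u|_N = Perm.subtypePerm`, `ū = QuotientGroup.congr N N u _`.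
* (c) (g50-#7) Theorem 3.2 of the source ("`[−1 / R/b] = (−1)^{(|b|−1)/2}`: `x ↦ −x` is `(|b|−1)/2` 2-cycles") generalized:
  `two_mul_card_halfSystem_add_one` (`#S = (#G−1)/2`), **`sign_inv_eq_neg_one_pow`** (inversion on any odd-order group has sign
  `(−1)^{(#G−1)/2}`), `sign_neg_eq_neg_one_pow` (additive: Theorem 3.2 for any finite ring of odd order), `sign_toPerm_neg_one_zmod`
  (`R = ℤ`).

## References

* [BrunyateClark2014] A. Brunyate, P. L. Clark, *Extending the Zolotarev–Frobenius approach to quadratic reciprocity*,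
  Ramanujan J. 37 (2015) 25–50, §6 Theorem 6.2, §3.2 Theorem 3.2.
* P. Cartier, *Sur une généralisation des symboles de Legendre–Jacobi*, Enseignement Math. (2) 16 (1970) 31–48 (the original,
  as cited in [BrunyateClark2014], [Ca70]).
* [Lemmermeyer2021] F. Lemmermeyer, *Quadratic Number Fields*, Springer (2021), §3.2.4 (Frobenius' pairing argument, the
  model for the proof of (a)).
-/

open Equiv Equiv.Perm Finset Literature.NumberTheory.Congruences.Zolotarev

namespace Literature.GroupTheory

variable {G : Type*} [Group G]

/-! ### (a) The generalized Gauss lemma -/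

/-- **THEOREM 6.2 (a) (Cartier), generalized Gauss lemma.** "Let `u` be an automorphism of a finite odd order group `G`.
a) Let `S ⊂ G ∖ {e}` be such that `S ∩ S^{−1} = ∅` and `S ∪ S^{−1} = G ∖ {e}`. Then the signature of `u` on `G` is
`(−1)^{#(u(S) ∩ S^{−1})}`." Typed for any permutation `u` of `G` commuting with inversion (`u(x^{−1}) = u(x)^{−1}`: automorphisms,
power maps `x ↦ x^a`), the half system `S` given by `e ∉ S` and "exactly one of `x, x^{−1}` lies in `S`" for `x ≠ e` (such an
`S` exists iff `G` has odd order), and the exponent as `#{s ∈ S : u(s) ∉ S}` (`= #(u(S) ∩ S^{−1})`, see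
`card_filter_not_mem_eq_card_image_inter`). Proof (Frobenius' pairing argument, as for `ℤ/m` in
`GaussLemmaHalfSystem.sign_toPerm_eq_neg_one_pow_card_of_halfSystem`): `(t, s) ↦ s^t` identifies `{±1} × S` with `G ∖ {e}` and
conjugates `u` to `(t, s) ↦ (ε_s t, ρ s)` (`u(s) = ρ(s)^{ε_s}`, `ρ(s) ∈ S`), of sign `(sign ρ)^2 ∏_s ε_s`.
[cite: BrunyateClark2014, §6 Thm. 6.2 (a) (Cartier 1970)] -/
theorem sign_eq_neg_one_pow_card_of_halfSystem [Fintype G] [DecidableEq G] {S : Finset G} (h1 : (1 : G) ∉ S)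
    (hS : ∀ x : G, x ≠ 1 → (x ∈ S ↔ x⁻¹ ∉ S)) (u : Perm G) (hu : ∀ x, u x⁻¹ = (u x)⁻¹) :
    ((Perm.sign u : ℤˣ) : ℤ) = (-1) ^ #{x ∈ S | u x ∉ S} := by
  classical
  -- bookkeeping for the half system
  have hne : ∀ x ∈ S, x ≠ 1 := fun x hx hx1 => h1 (hx1 ▸ hx)
  have hinv : ∀ x : G, x ≠ 1 → x ∉ S → x⁻¹ ∈ S := fun x hx hxS => by_contra fun h => hxS ((hS x hx).mpr h)
  have hpm : ∀ x y : S, ((x : G) = y ∨ (x : G) = (y : G)⁻¹) → x = y := by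
    rintro x y (h | h)
    · exact Subtype.ext h
    · exact absurd (h ▸ x.2) ((hS y (hne _ y.2)).mp y.2)
  -- no element is its own inverse, except `e`; in particular `u(e) = e`
  have hself : ∀ x : G, x⁻¹ = x → x = 1 := fun x hx => by
    by_contra hx1
    have h := hS x hx1
    rw [hx] at h
    exact iff_not_self h
  have hu1 : u 1 = 1 := hself _ (by rw [← hu, inv_one])
  -- Step 0: `e` is fixed; restrict to `G ∖ {e}`
  have hp : ∀ x, u x ≠ 1 ↔ x ≠ 1 := fun x =>
    ⟨fun h h1 => h (by rw [h1, hu1]), fun h h1 => h (u.injective (h1.trans hu1.symm))⟩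
  have hfix : ∀ x, u x ≠ x → x ≠ 1 := fun x hx hx1 => hx (by rw [hx1, hu1])
  rw [← sign_subtypePerm u hp hfix]
  -- Step 1: the signs `ε_s` (`u s ∈ S` or not) and the permutation `ρ` of `S` with `u s = ρ(s)^{ε_s}`
  obtain ⟨ε, hε⟩ : ∃ ε : S → ℤˣ, ∀ x, ε x = if u x ∈ S then 1 else -1 := ⟨_, fun _ => rfl⟩
  have hρmem : ∀ x : S, (u x) ^ ((ε x : ℤˣ) : ℤ) ∈ S := by
    intro x
    by_cases hx : u x ∈ S
    · rw [hε, if_pos hx, Units.val_one, zpow_one]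
      exact hx
    · rw [hε, if_neg hx, Units.val_neg, Units.val_one, zpow_neg, zpow_one]
      exact hinv _ ((hp x).mpr (hne _ x.2)) hx
  have hρinj : Function.Injective fun x : S => (⟨_, hρmem x⟩ : S) := by
    intro x y hxy
    have hv : (u x) ^ ((ε x : ℤˣ) : ℤ) = (u y) ^ ((ε y : ℤˣ) : ℤ) := congrArg Subtype.val hxy
    apply hpm
    rcases Int.units_eq_one_or (ε x) with hx | hx <;> rcases Int.units_eq_one_or (ε y) with hy | hy <;>
      simp only [hx, hy, Units.val_one, Units.val_neg, zpow_one, zpow_neg, inv_inj] at hv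
    · exact Or.inl (u.injective hv)
    · exact Or.inr (u.injective (by rw [hv, hu]))
    · exact Or.inr (u.injective (by rw [hu, ← hv, inv_inv]))
    · exact Or.inl (u.injective hv)
  obtain ⟨ρ, hρ⟩ : ∃ ρ : Perm S, ∀ x : S, ((ρ x : S) : G) = (u x) ^ ((ε x : ℤˣ) : ℤ) :=
    ⟨Equiv.ofBijective _ (Finite.injective_iff_bijective.mp hρinj), fun _ => rfl⟩
  -- Step 2: `(t, s) ↦ s^t`, `{±1} × S ≃ G ∖ {e}`
  have hemem : ∀ p : ℤˣ × S, (p.2 : G) ^ ((p.1 : ℤˣ) : ℤ) ≠ 1 := by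
    rintro ⟨t, x⟩
    rcases Int.units_eq_one_or t with rfl | rfl
    · rw [Units.val_one, zpow_one]
      exact hne _ x.2
    · rw [Units.val_neg, Units.val_one, zpow_neg, zpow_one, Ne, inv_eq_one]
      exact hne _ x.2
  have hebij : Function.Bijective fun p : ℤˣ × S => (⟨_, hemem p⟩ : {x : G // x ≠ 1}) := by
    constructor
    · rintro ⟨s, x⟩ ⟨t, y⟩ hst
      have hv : (x : G) ^ ((s : ℤˣ) : ℤ) = (y : G) ^ ((t : ℤˣ) : ℤ) := congrArg Subtype.val hst
      rcases Int.units_eq_one_or s with rfl | rfl <;> rcases Int.units_eq_one_or t with rfl | rfl <;>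
        simp only [Units.val_one, Units.val_neg, zpow_one, zpow_neg, inv_inj] at hv
      · rw [hpm x y (Or.inl hv)]
      · exfalso
        have hxy : x = y := hpm x y (Or.inr hv)
        subst hxy
        exact hne _ x.2 (hself _ hv.symm)
      · exfalso
        have hxy : x = y := hpm x y (Or.inr (by rw [← hv, inv_inv]))
        subst hxy
        exact hne _ x.2 (hself _ hv)
      · rw [hpm x y (Or.inl hv)]
    · rintro ⟨z, hz⟩
      by_cases hzS : z ∈ S
      · exact ⟨(1, ⟨z, hzS⟩), Subtype.ext (by simp)⟩
      · exact ⟨(-1, ⟨z⁻¹, hinv z hz hzS⟩), Subtype.ext (by simp)⟩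
  obtain ⟨e, he⟩ : ∃ e : ℤˣ × S ≃ {x : G // x ≠ 1},
      ∀ p, ((e p : {x : G // x ≠ 1}) : G) = (p.2 : G) ^ ((p.1 : ℤˣ) : ℤ) :=
    ⟨Equiv.ofBijective _ hebij, fun _ => rfl⟩
  -- Step 3: under `e`, `u` becomes `τ : (t, s) ↦ (ε_s t, ρ s)`
  set τ : Perm (ℤˣ × S) :=
    (prodCongrRight fun _ : ℤˣ => ρ) * prodCongrLeft fun x : S => (MulAction.toPerm (ε x) : Perm ℤˣ) with hτ
  have hcomm : ∀ p, e (τ p) = (u.subtypePerm hp) (e p) := by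
    rintro ⟨s, x⟩
    apply Subtype.ext
    have hR : (((u.subtypePerm hp) (e (s, x)) : {y : G // y ≠ 1}) : G) = u (e (s, x) : G) := rfl
    rw [hR, he, he, hτ, Perm.mul_apply, prodCongrLeft_apply, MulAction.toPerm_apply, smul_eq_mul,
      prodCongrRight_apply]
    dsimp only
    rw [hρ x, ← zpow_mul, Units.val_mul, ← mul_assoc, Int.units_coe_mul_self, one_mul]
    -- `u (x ^ s) = (u x) ^ s` for `s = ±1`
    rcases Int.units_eq_one_or s with rfl | rfl
    · rw [Units.val_one, zpow_one, zpow_one]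
    · rw [Units.val_neg, Units.val_one, zpow_neg, zpow_one, zpow_neg, zpow_one, hu]
  -- Step 4: signs, by (3.3)
  rw [← sign_eq_sign_of_equiv τ (u.subtypePerm hp) e hcomm, hτ, Perm.sign_mul, sign_prodCongrRight, sign_prodCongrLeft,
    Finset.prod_const, Finset.card_univ, Fintype.card_units_int, Int.units_sq, one_mul]
  simp_rw [sign_toPerm_units_int]
  rw [Units.coe_prod]
  have hεZ : ∀ x : S, ((ε x : ℤˣ) : ℤ) = if u x ∈ S then (1 : ℤ) else -1 := by
    intro x
    rw [hε]
    split_ifs <;> rfl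
  simp_rw [hεZ]
  rw [Finset.prod_coe_sort S (fun y : G => if u y ∈ S then (1 : ℤ) else -1), Finset.prod_ite, Finset.prod_const_one,
    one_mul, Finset.prod_const]

/-- **THEOREM 6.2 (a) for an automorphism `u`**, the printed case: `ϵ(u) = (−1)^{#{s ∈ S : u(s) ∉ S}}`.
[cite: BrunyateClark2014, §6 Thm. 6.2 (a) (Cartier 1970)] -/
theorem sign_mulEquiv_eq_neg_one_pow_card_of_halfSystem [Fintype G] [DecidableEq G] {S : Finset G} (h1 : (1 : G) ∉ S)
    (hS : ∀ x : G, x ≠ 1 → (x ∈ S ↔ x⁻¹ ∉ S)) (u : G ≃* G) :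
    ((Perm.sign (u.toEquiv : Perm G) : ℤˣ) : ℤ) = (-1) ^ #{x ∈ S | u x ∉ S} :=
  sign_eq_neg_one_pow_card_of_halfSystem h1 hS (u.toEquiv : Perm G) fun x => map_inv u x

/-- The printed exponent: `#(u(S) ∩ S^{−1}) = #{s ∈ S : u(s) ∉ S}` for a half system `S` and `u` commuting with inversion.
[cite: BrunyateClark2014, §6 Thm. 6.2 (a)] -/
theorem card_image_inter_image_inv_eq [DecidableEq G] {S : Finset G} (h1 : (1 : G) ∉ S)
    (hS : ∀ x : G, x ≠ 1 → (x ∈ S ↔ x⁻¹ ∉ S)) (u : Perm G) (hu : ∀ x, u x⁻¹ = (u x)⁻¹) :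
    #(S.image u ∩ S.image (·⁻¹)) = #{x ∈ S | u x ∉ S} := by
  have hself : ∀ x : G, x⁻¹ = x → x = 1 := fun x hx => by
    by_contra hx1
    have h := hS x hx1
    rw [hx] at h
    exact iff_not_self h
  have hu1 : u 1 = 1 := hself _ (by rw [← hu, inv_one])
  have hne : ∀ x ∈ S, x ≠ 1 := fun x hx hx1 => h1 (hx1 ▸ hx)
  -- `u` restricted to `{s ∈ S : u s ∉ S}` is a bijection onto `u(S) ∩ S⁻¹`
  symm
  refine card_nbij (fun x => u x) (fun x hx => ?_) (fun x _ y _ hxy => u.injective hxy) (fun y hy => ?_)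
  · rw [mem_coe, mem_filter] at hx
    rw [mem_coe, mem_inter, mem_image, mem_image]
    have hux : u x ≠ 1 := by rw [Ne, ← hu1, u.injective.eq_iff]; exact hne _ hx.1
    refine ⟨⟨x, hx.1, rfl⟩, ⟨(u x)⁻¹, ?_, inv_inv _⟩⟩
    by_contra h
    exact hx.2 ((hS _ hux).mpr h)
  · rw [mem_coe, mem_inter, mem_image, mem_image] at hy
    obtain ⟨⟨x, hxS, rfl⟩, ⟨z, hzS, hz⟩⟩ := hy
    refine ⟨x, ?_, rfl⟩
    rw [mem_coe, mem_filter]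
    refine ⟨hxS, fun huxS => ?_⟩
    have hz' : z = (u x)⁻¹ := by rw [← hz, inv_inv]
    exact (hS z (hne _ hzS)).mp hzS (by rw [hz', inv_inv]; exact huxS)

/-- **A half system exists iff the order is odd**, forward direction used by Theorem 6.2: a finite group of odd order has a
subset `S ∌ e` containing exactly one of `x, x^{−1}` for every `x ≠ e` (no `x ≠ e` is its own inverse).
[cite: BrunyateClark2014, §6 Thm. 6.2 (a) (the hypothesis "S ∩ S⁻¹ = ∅, S ∪ S⁻¹ = G ∖ {e}")] -/
theorem exists_halfSystem_of_odd_card [Fintype G] [DecidableEq G] (hG : Odd (Fintype.card G)) :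
    ∃ S : Finset G, (1 : G) ∉ S ∧ ∀ x : G, x ≠ 1 → (x ∈ S ↔ x⁻¹ ∉ S) := by
  classical
  -- no element of order `2`
  have h2 : ∀ x : G, x⁻¹ = x → x = 1 := by
    intro x hx
    have hx2 : x ^ 2 = 1 := by
      rw [pow_two]
      nth_rw 1 [← hx]
      exact inv_mul_cancel x
    have hodd : Odd (orderOf x) := hG.of_dvd_nat orderOf_dvd_card
    have hdvd : orderOf x ∣ 2 := orderOf_dvd_of_pow_eq_one hx2
    have h1 : orderOf x = 1 := by
      rcases (Nat.dvd_prime Nat.prime_two).mp hdvd with h | h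
      · exact h
      · exact absurd (h ▸ hodd) (by decide)
    exact orderOf_eq_one_iff.mp h1
  -- choose, along an enumeration `G ≃ Fin |G|`, the smaller of `x, x⁻¹`
  let f := Fintype.equivFin G
  refine ⟨univ.filter fun x => x ≠ 1 ∧ f x < f x⁻¹, by simp, fun x hx => ?_⟩
  have hne : f x ≠ f x⁻¹ := fun h => hx (h2 x (f.injective h).symm)
  simp only [mem_filter, mem_univ, true_and, inv_inv, ne_eq, inv_eq_one, not_and, not_lt]
  constructor
  · rintro ⟨-, h⟩ -
    exact h.le
  · intro h
    exact ⟨hx, lt_of_le_of_ne (h hx) hne⟩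

/-! ### (b) `ϵ_G(u) = ϵ_N(u|_N) · ϵ_{G/N}(ū)` for a `u`-stable normal subgroup `N` -/

/-- A `u`-stable subgroup (`u(x) ∈ N ⟺ x ∈ N`) has `u(N) = N`. [folklore] -/
private theorem map_eq_of_forall_mem_iff (N : Subgroup G) (u : G ≃* G) (hmem : ∀ x, u x ∈ N ↔ x ∈ N) :
    N.map (u : G →* G) = N := by
  ext y
  rw [Subgroup.mem_map]
  constructor
  · rintro ⟨x, hx, rfl⟩
    exact (hmem x).mpr hx
  · intro hy
    exact ⟨u.symm y, (hmem _).mp (by rwa [MulEquiv.apply_symm_apply]), by simp⟩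

/-- **THEOREM 6.2 (b) (Cartier).** "Let `u` be an automorphism of a finite odd order group `G`. … b) If `u` stabilizes a normal
subgroup `N` of `G`, the signature of `u` on `G` is equal to the signature of `u` on `N` times the signature of the induced
automorphism on `G/N`." Proof: along `G ≃ (G/N) × N` by coset representatives `q̄` (`exists_equiv_quotient_prod`), `u` becomes
`(q, n) ↦ (ū q, c_q · u(n))` with `c_q = \overline{ū q}^{−1} u(q̄) ∈ N`; by (3.3) its sign is `ϵ(ū)^{#N} · ∏_q ϵ(c_q ·) ϵ(u|_N) =
ϵ(ū) ϵ(u|_N)`, translations of the odd-order group `N` being even (Lemma 2.2 (b)) and `#N`, `#G/N` odd.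
[cite: BrunyateClark2014, §6 Thm. 6.2 (b) (Cartier 1970)] -/
theorem sign_eq_sign_subtypePerm_mul_sign_quotient [Fintype G] [DecidableEq G] (hG : Odd (Fintype.card G))
    (N : Subgroup G) [N.Normal] [Fintype N] [Fintype (G ⧸ N)] [DecidableEq (G ⧸ N)] (u : G ≃* G)
    (hmem : ∀ x, u x ∈ N ↔ x ∈ N) :
    Perm.sign (u.toEquiv : Perm G) =
      Perm.sign (Perm.subtypePerm (u.toEquiv : Perm G) hmem : Perm N) *
        Perm.sign ((QuotientGroup.congr N N u (map_eq_of_forall_mem_iff N u hmem)).toEquiv : Perm (G ⧸ N)) := by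
  classical
  obtain ⟨e, he⟩ := exists_equiv_quotient_prod N
  set ubar : G ⧸ N ≃* G ⧸ N := QuotientGroup.congr N N u (map_eq_of_forall_mem_iff N u hmem) with hubar
  set uN : Perm N := Perm.subtypePerm (u.toEquiv : Perm G) hmem with huN
  have hubar_mk : ∀ g : G, ubar (g : G ⧸ N) = ((u g : G) : G ⧸ N) := fun g => rfl
  -- the correcting elements `c_q = (ū q)‾⁻¹ · u(q̄) ∈ N`
  have hc : ∀ q : G ⧸ N, ((ubar q).out)⁻¹ * u q.out ∈ N := by
    intro q
    rw [← QuotientGroup.eq, QuotientGroup.out_eq', ← hubar_mk, QuotientGroup.out_eq']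
  -- `u` along `e` is `τ : (q, n) ↦ (ū q, c_q · u n)`
  set τ : Perm ((G ⧸ N) × N) := (prodCongrLeft fun _ : N => ubar.toEquiv) *
    prodCongrRight fun q : G ⧸ N => (MulAction.toPerm (⟨_, hc q⟩ : N) : Perm N) * uN with hτ
  have hcomm : ∀ p, e (τ p) = (u.toEquiv : Perm G) (e p) := by
    rintro ⟨q, n⟩
    rw [hτ, Perm.mul_apply, prodCongrRight_apply, Perm.mul_apply, MulAction.toPerm_apply, smul_eq_mul, prodCongrLeft_apply,
      he, he]
    change (ubar q).out * (((ubar q).out)⁻¹ * u q.out * (u n : G)) = u (q.out * n)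
    rw [map_mul, mul_assoc ((ubar q).out)⁻¹, mul_inv_cancel_left]
  have hNodd : Odd (Fintype.card N) := by
    rw [← Nat.card_eq_fintype_card]
    exact (Nat.card_eq_fintype_card (α := G) ▸ hG).of_dvd_nat N.card_subgroup_dvd_card
  have hQodd : Odd (Fintype.card (G ⧸ N)) := by
    rw [← Nat.card_eq_fintype_card]
    exact (Nat.card_eq_fintype_card (α := G) ▸ hG).of_dvd_nat N.card_quotient_dvd_card
  apply Units.val_injective
  rw [← sign_eq_sign_of_equiv τ _ e hcomm, hτ, Perm.sign_mul, sign_prodCongrLeft, sign_prodCongrRight, Finset.prod_const,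
    Finset.card_univ]
  simp_rw [Perm.sign_mul, sign_toPerm_self_eq_one_of_odd_card hNodd, one_mul]
  rw [Finset.prod_const, Finset.card_univ, Units.val_mul, Units.val_mul, Units.val_pow_eq_pow_val, Units.val_pow_eq_pow_val,
    units_int_pow_of_odd _ hNodd, units_int_pow_of_odd _ hQodd, mul_comm]

/-! ### (c) Theorem 3.2, generalized: the signature of inversion `x ↦ x^{−1}` is `(−1)^{(#G−1)/2}` -/

/-- A half system has `(#G − 1)/2` elements: `G ∖ {e} = S ⊔ S^{−1}`. [cite: BrunyateClark2014, §6 Thm. 6.2 (a) (the hypothesis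
"S ∩ S⁻¹ = ∅, S ∪ S⁻¹ = G ∖ {e}") and §3.2 Thm. 3.2 (proof: "(|b|−1)/2 2-cycles")] -/
theorem two_mul_card_halfSystem_add_one [Fintype G] [DecidableEq G] {S : Finset G} (h1 : (1 : G) ∉ S)
    (hS : ∀ x : G, x ≠ 1 → (x ∈ S ↔ x⁻¹ ∉ S)) : 2 * #S + 1 = Fintype.card G := by
  have hne : ∀ x ∈ S, x ≠ 1 := fun x hx hx1 => h1 (hx1 ▸ hx)
  have hdisj : Disjoint S (S.image fun x => x⁻¹) := by
    rw [Finset.disjoint_left]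
    rintro x hx hx'
    obtain ⟨y, hy, rfl⟩ := mem_image.mp hx'
    exact (hS y (hne y hy)).mp hy hx
  have hunion : S ∪ S.image (fun x => x⁻¹) = univ.erase 1 := by
    ext x
    rw [mem_union, mem_image, mem_erase, and_iff_left (mem_univ x)]
    constructor
    · rintro (hx | ⟨y, hy, rfl⟩)
      · exact hne x hx
      · exact inv_ne_one.mpr (hne y hy)
    · intro hx
      by_cases hxS : x ∈ S
      · exact Or.inl hxS
      · exact Or.inr ⟨x⁻¹, by_contra fun h => hxS ((hS x hx).mpr h), inv_inv x⟩
  have hcard := congrArg Finset.card hunion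
  rw [card_union_of_disjoint hdisj, card_image_of_injective S inv_injective, card_erase_of_mem (mem_univ _),
    card_univ] at hcard
  have hpos : 0 < Fintype.card G := Fintype.card_pos
  omega

/-- **THEOREM 3.2, generalized from `(R/b, +)` to any finite group of odd order: the inversion `x ↦ x^{−1}` has signature
`(−1)^{(#G − 1)/2}`** ("the only `x` with `2x = 0` is `x = 0`. Thus `[−1/r]` is a product of `(|b|−1)/2` 2-cycles"): by (a) with
`u = ` inversion, every `s ∈ S` is flipped. (`#G / 2 = (#G − 1)/2` for odd `#G`; read in `ℤ`.)
[cite: BrunyateClark2014, §3.2 Thm. 3.2 (proof) with §6 Thm. 6.2 (a)] -/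
theorem sign_inv_eq_neg_one_pow [Fintype G] [DecidableEq G] (hG : Odd (Fintype.card G)) :
    ((Perm.sign (Equiv.inv G) : ℤˣ) : ℤ) = (-1) ^ (Fintype.card G / 2) := by
  obtain ⟨S, h1, hS⟩ := exists_halfSystem_of_odd_card hG
  have hne : ∀ x ∈ S, x ≠ 1 := fun x hx hx1 => h1 (hx1 ▸ hx)
  rw [sign_eq_neg_one_pow_card_of_halfSystem h1 hS (Equiv.inv G) fun x => rfl]
  have hall : S.filter (fun x => (Equiv.inv G) x ∉ S) = S := by
    refine filter_true_of_mem fun x hx => ?_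
    rw [Equiv.inv_apply]
    exact (hS x (hne x hx)).mp hx
  have hcard := two_mul_card_halfSystem_add_one h1 hS
  rw [hall, show Fintype.card G / 2 = #S by omega]

/-- **THEOREM 3.2 for a finite ring / additive group of odd order: `[−1/r] = ϵ(x ↦ −x) = (−1)^{(#r − 1)/2}`.**
("**Theorem 3.2.** Let `b` be an odd ideal in an abstract number ring `R`. Then `(−1/b) = [−1 / R/b] = (−1)^{(|b|−1)/2}`.")
[cite: BrunyateClark2014, §3.2 Thm. 3.2] -/
theorem sign_neg_eq_neg_one_pow {A : Type*} [AddGroup A] [Fintype A] [DecidableEq A] (hA : Odd (Fintype.card A)) :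
    ((Perm.sign (Equiv.neg A) : ℤˣ) : ℤ) = (-1) ^ (Fintype.card A / 2) := by
  rw [sign_eq_sign_of_equiv (Equiv.neg A) (Equiv.inv (Multiplicative A)) Multiplicative.ofAdd fun _ => rfl,
    sign_inv_eq_neg_one_pow (G := Multiplicative A) (by rwa [Fintype.card_multiplicative]), Fintype.card_multiplicative]

/-- **THEOREM 3.2 for `R = ℤ`: `[−1 / ℤ/bℤ] = (−1)^{(b−1)/2}`** for odd `b` — the sign of `x ↦ −x` on `ℤ/b` (so, with
`ZolotarevLemmaJacobi.zolotarev_jacobiSym`, `(−1/b) = (−1)^{(b−1)/2}`; Mathlib: `jacobiSym.at_neg_one`).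
[cite: BrunyateClark2014, §3.2 Thm. 3.2] -/
theorem sign_toPerm_neg_one_zmod {b : ℕ} [NeZero b] (hb : Odd b) :
    ((Perm.sign (MulAction.toPerm (-1 : (ZMod b)ˣ) : Perm (ZMod b)) : ℤˣ) : ℤ) = (-1) ^ (b / 2) := by
  have h : (MulAction.toPerm (-1 : (ZMod b)ˣ) : Perm (ZMod b)) = Equiv.neg (ZMod b) :=
    Equiv.ext fun x => by rw [MulAction.toPerm_apply, Units.smul_def, Units.val_neg, Units.val_one, smul_eq_mul, neg_one_mul]; rfl
  rw [h, sign_neg_eq_neg_one_pow (by rwa [ZMod.card]), ZMod.card]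

end Literature.GroupTheory
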